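import Summits.BirchSwinnertonDyer.BirchSwinnertonDyer.Theorems.PrintCf2SplitBadTwoKummerBranchFrame
import Summits.BirchSwinnertonDyer.BirchSwinnertonDyer.Theorems.PrintCf2SplitBadTwoCMShaSelmerBranchDichotomy
import Summits.BirchSwinnertonDyer.BirchSwinnertonDyer.Theorems.PrintCf2SplitBadTwoCMShaBottomValueOfSel
import Summits.BirchSwinnertonDyer.BirchSwinnertonDyer.Theorems.PrintCf2SplitBadTwoRestrictedSelmerConjTransportFrame
import Summits.BirchSwinnertonDyer.BirchSwinnertonDyer.Theorems.PrintCf2SplitBadTwoCMShaModule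
import HarnessLib

/-!
# Crux `PrintCf2.SplitBadTwoRankOneOfFacts` (stmt-BirchSwinnertonDyer-20368), road α v10.3, S3c residual (R-BV) — file 6 of the branch
# argument: (INF′) DISCHARGED; (H1-Sel) and (R-BV) per frame modulo ONE local statement, the cyclicity of the `2`-torsion of the
# classical classes at `v`

Cell `bsd-print-cf2`, EXTRA WIDTH seat `bsd-line-cf2-p1-w3` g9 (prover-bsd-line-cf2-p1-w3-g9-0); `--supports stmt-BirchSwinnertonDyer-20368`
(helper, Theses-free). HONEST FRAMING: nothing here closes the crux or a registered stub; BSD is not proved by any of this; no summit statement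
is proved by this seat. No definition, no named fact, no `sorry`, no kit. beyond-print theorem: no.

WHAT. -w8 g2's `CMPrimes.sel_input_of_finite_conj` (p673xxx, `…CMShaSelmerBranchDichotomy`) runs the dichotomy-and-exclusion of p671916 on
`Q = res_⊤ Sel_{p^∞}(E_K/K)` and displays three inputs: `hfin′` (finiteness of the CONJUGATE restricted group — the frame's `hfin` by -w2 g10's
`ConjTransport.finite_restrictedSelmerBase_conj_of_finite`), (INF′) «`ι′_*⁻¹(res_⊤ range κ)` is infinite» and (T-loc-Sel) «the `p`-torsion of
`loc_v(res_⊤ Sel)` is cyclic». Here: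
* §1 `not_finite_comap_conj_kummer` — **(INF′) PROVED** for any `V/K`, `p`, CM-type pair `(π, r, r′)` with `IsUnit (r − r′)`, `π² = π − 2`,
  complementary summands and a `K`-point of infinite order: `e′_* Q ≤ ι′_*⁻¹ Q` (`map_proj_conj_le_comap_of_stable` + `resSubgroup_kummer_stable`)
  and `e′_* Q` is infinite ((INF) ⟸ (IND), p672752 + p673070, Mordell–Weil).
* §1 `local_cyclic_mono`, `map_resSubgroup_selmer_le_localKerOver`, `map_resSubgroup_kummer_le_map_resSubgroup_selmer` — the cyclicity
  statement is ANTITONE in the subgroup, and `res_⊤ range κ ≤ res_⊤ Sel ≤ localKerOver p ⊤ K_v`; so ONE local statement (T-loc-cl at `v`)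
  «the `p`-torsion of `loc_v(classical-at-v classes)` is cyclic» gives both (T-loc) (p673070/p673486) and (T-loc-Sel) (-w8 g2).
* §2 on road α's frame: `not_finite_comap_conj_kummer_of_frame` ((INF′) per frame, no `v`, no `hK`), **`sel_input_of_frame_of_locCyclic`**
  ((H1-Sel) per frame ⟸ (T-loc-cl at `v`) ∧ the frame's `hfin`; `φ` from `exists_isogeny_apply_eq_cmEndo`), **`hSel_of_locCyclic`** (the
  hypothesis `hSel` of -w8 g2's `rBV_of_factor_values_of_sel`, VERBATIM, ⟸ (T-loc-cl)-all) and **`rBV_of_factor_values_of_locCyclic`**: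
  (R-BV) of LEAD g12 VERBATIM ⟸ (F1) ∧ (F3) ∧ (H2) ∧ (T-loc-cl)-all — the CM input of the bottom value is now ONE LOCAL CYCLICITY (a statement
  about `E(K_v) = E(ℚ₂)`, -w7 g3's lane: p672775 `exists_resOfLe_eq_zsmul_resOfLe_kummer` + p671939 rank one).

presearch: assembly of tree theorems only; no Literature fact filed.

References: [Agboola2007] §6 (arXiv p0014:L5), Props. 6.10–6.11, 8.1; [GreenbergLNM1716] §2 Prop. 2.1; [Rubin1999] §2.
-/

noncomputable section

open scoped Classical

set_option linter.dupNamespace false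
set_option autoImplicit false

open NumberField IsDedekindDomain Field WeierstrassCurve
open Literature.NumberTheory.EllipticCurves Literature.NumberTheory.EllipticCurves.GreenbergSelmer
open Literature.NumberTheory.EllipticCurves.Castella2018.AcSelmer
open Literature.NumberTheory.EllipticCurves.Agboola2007
open Literature.NumberTheory.EllipticCurves.ResKernel
open Literature.NumberTheory.GaloisRepresentations

universe u

/-! ## §1. Generic: (INF′), and the monotonicity of the local cyclicity statement -/

namespace Summit.BirchSwinnertonDyer.BirchSwinnertonDyer.Theorems.PrintCf2.RestrictedSelmerPair

section Generic

variable {K : Type u} [Field K] [NumberField K] (V : WeierstrassCurve K) [V.IsElliptic] (p : ℕ) [Fact p.Prime]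
  (π : V.endRing) (r r' : ℤ_[p]) (v : HeightOneSpectrum (𝓞 K))

/-- **(INF′): the conjugate summand carries infinitely many Kummer classes** — `ι′_*⁻¹(res_⊤ range κ)` is infinite, for a CM-type pair of
complementary summands `E[p^∞] = M_r ⊕ M_{r′}` (`IsUnit (r − r′)`, `π² = π − 2`) and a `K`-point of infinite order: `e′_*(res_⊤ range κ) ≤
ι′_*⁻¹(res_⊤ range κ)` by stability, and `e′_*(res_⊤ range κ)` is infinite by (IND) (the classes of `w • (πP − N₂ P)` at all levels).
[cite: Agboola2007, §6 (arXiv p0014:L5)] [cite: SilvermanAEC2009, VIII §1] -/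
theorem not_finite_comap_conj_kummer (hunit : IsUnit (r - r')) (hrel : (π : AddMonoid.End V.geomPoints) * π = π - 2)
    (hinf : V.endEigenPrimaryTorsion p π r ⊓ V.endEigenPrimaryTorsion p π r' = ⊥)
    (hsup : V.endEigenPrimaryTorsion p π r ⊔ V.endEigenPrimaryTorsion p π r' = ⊤)
    (P₀ : V.toAffine.Point) (hP₀ : ¬ IsOfFinAddOrder P₀) :
    ¬ Finite ↥((((V.kummerMapPInfty p V.zsmul_geomPoints_surjective_holds).range).map
        (resSubgroup ⊤ (V.geomPrimaryTorsion p))).comap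
        (resH1Hom (ContinuousMonoidHom.id (⊤ : Subgroup (absoluteGaloisGroup K))) (V.endEigenPrimaryTorsion p π r').subtype
          (fun _ _ ↦ rfl))) := by
  obtain ⟨e, -, -, he₃, he⟩ := exists_eigenProjector V p π r r' hinf hsup
  obtain ⟨e', he'₁, he'₂, -, he'⟩ := exists_eigenProjector V p π r' r (by rw [inf_comm]; exact hinf) (by rw [sup_comm]; exact hsup)
  have hsum := coe_proj_add_coe_proj V p π r r' e e' he₃ he'₁ he'₂
  intro hfin
  have hle := map_proj_conj_le_comap_of_stable V p π r r' e e' he he' hsum _ (resSubgroup_kummer_stable V p π r r' hunit e e' he hsum)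
  haveI := hfin
  exact not_finite_map_proj_conj_kummer_of_forall V p π r r' e e' he' hsum (kummer_ind_of_not_isOfFinAddOrder V p π r r' hunit hrel P₀ hP₀)
    (Finite.of_injective _ (AddSubgroup.inclusion_injective hle))

omit [NumberField K] [V.IsElliptic] [Fact p.Prime] in
/-- **The local cyclicity statement is antitone in the subgroup**: if the `p`-torsion of `T` is cyclic in the sense «every `p`-torsion
element is an integer multiple of any non-zero one», so is that of every `S ≤ T`. [folklore] -/
theorem local_cyclic_mono {A : Type*} [AddCommGroup A] {S T : AddSubgroup A} (hST : S ≤ T)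
    (hT : ∀ x ∈ T, ∀ y ∈ T, p • x = 0 → p • y = 0 → x ≠ 0 → ∃ m : ℤ, y = m • x) :
    ∀ x ∈ S, ∀ y ∈ S, p • x = 0 → p • y = 0 → x ≠ 0 → ∃ m : ℤ, y = m • x :=
  fun x hx y hy ↦ hT x (hST hx) y (hST hy)

omit [V.IsElliptic] [Fact p.Prime] in
/-- **Selmer classes are classical at `v`**: `res_⊤ Sel_{p^∞}(E_K/K) ≤ localKerOver p ⊤ K_v` (the local condition of `Sel_{p^∞}` at `v` IS the
classical one, `resSubgroup_top_mem_localKerOver`). [cite: GreenbergLNM1716, §2] -/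
theorem map_resSubgroup_selmer_le_localKerOver (E : Type u) [Field E] [Algebra K E]
    (hE : ∀ c ∈ V.selmerGroupPInfty p, c ∈ V.selmerLocalKerPrimary E p) :
    (V.selmerGroupPInfty p).map (resSubgroup ⊤ (V.geomPrimaryTorsion p)) ≤ V.localKerOver p ⊤ E := by
  rintro _ ⟨c, hc, rfl⟩
  exact V.resSubgroup_top_mem_localKerOver (hE c hc)

omit [V.IsElliptic] [Fact p.Prime] in
/-- At a finite place `v`, every Selmer class satisfies the local condition at `K_v`. [cite: GreenbergLNM1716, §2] -/
theorem selmerLocalKerPrimary_of_mem_selmerGroupPInfty {c : V.galH1Primary p} (hc : c ∈ V.selmerGroupPInfty p) :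
    c ∈ V.selmerLocalKerPrimary (v.adicCompletion K) p :=
  AddSubgroup.mem_iInf.mp (AddSubgroup.mem_inf.mp hc).1 v

omit [V.IsElliptic] [Fact p.Prime] in
/-- `res_⊤ Sel_{p^∞}(E_K/K) ≤ localKerOver p ⊤ K_v` at a finite place `v`. [cite: GreenbergLNM1716, §2] -/
theorem map_resSubgroup_selmer_le_localKerOver_adicCompletion :
    (V.selmerGroupPInfty p).map (resSubgroup ⊤ (V.geomPrimaryTorsion p)) ≤ V.localKerOver p ⊤ (v.adicCompletion K) :=
  map_resSubgroup_selmer_le_localKerOver V p (v.adicCompletion K) (fun _ hc ↦ selmerLocalKerPrimary_of_mem_selmerGroupPInfty V p v hc)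

/-- **Kummer classes are Selmer classes**: `res_⊤ range κ ≤ res_⊤ Sel_{p^∞}(E_K/K)` (`range κ = ker(H¹(K,E[p^∞]) → H¹(K,E)) ≤ Sel`).
[cite: SilvermanAEC2009, Thm X.4.2(a)] -/
theorem map_resSubgroup_kummer_le_map_resSubgroup_selmer :
    ((V.kummerMapPInfty p V.zsmul_geomPoints_surjective_holds).range).map (resSubgroup ⊤ (V.geomPrimaryTorsion p)) ≤
      (V.selmerGroupPInfty p).map (resSubgroup ⊤ (V.geomPrimaryTorsion p)) := by
  refine AddSubgroup.map_mono ?_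
  rw [V.range_kummerMapPInfty p]
  exact V.ker_primaryH1ToH1_le_selmerGroupPInfty p

omit [V.IsElliptic] [Fact p.Prime] in
/-- **(T-loc-Sel) ⟸ (T-loc-cl)**: cyclicity of the `p`-torsion of `loc_v` of the classical classes gives it for `loc_v(res_⊤ Sel)`.
[cite: GreenbergLNM1716, §2] -/
theorem sel_local_cyclic_of_classical
    (hcl : ∀ x ∈ (V.localKerOver p ⊤ (v.adicCompletion K)).map (resOfLe (V.geomPrimaryTorsion p) (inf_le_left : ⊤ ⊓ decomp v ≤ ⊤)),
      ∀ y ∈ (V.localKerOver p ⊤ (v.adicCompletion K)).map (resOfLe (V.geomPrimaryTorsion p) (inf_le_left : ⊤ ⊓ decomp v ≤ ⊤)),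
      p • x = 0 → p • y = 0 → x ≠ 0 → ∃ m : ℤ, y = m • x) :
    ∀ x ∈ ((V.selmerGroupPInfty p).map (resSubgroup ⊤ (V.geomPrimaryTorsion p))).map
        (resOfLe (V.geomPrimaryTorsion p) (inf_le_left : ⊤ ⊓ decomp v ≤ ⊤)),
      ∀ y ∈ ((V.selmerGroupPInfty p).map (resSubgroup ⊤ (V.geomPrimaryTorsion p))).map
        (resOfLe (V.geomPrimaryTorsion p) (inf_le_left : ⊤ ⊓ decomp v ≤ ⊤)),
      p • x = 0 → p • y = 0 → x ≠ 0 → ∃ m : ℤ, y = m • x :=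
  local_cyclic_mono p (AddSubgroup.map_mono (map_resSubgroup_selmer_le_localKerOver_adicCompletion V p v)) hcl

/-- **(T-loc) ⟸ (T-loc-cl)**: the same for `loc_v(res_⊤ range κ)` (hypothesis `hcyc` of p673070 / p673486). [cite: GreenbergLNM1716, §2] -/
theorem kummer_local_cyclic_of_classical
    (hcl : ∀ x ∈ (V.localKerOver p ⊤ (v.adicCompletion K)).map (resOfLe (V.geomPrimaryTorsion p) (inf_le_left : ⊤ ⊓ decomp v ≤ ⊤)),
      ∀ y ∈ (V.localKerOver p ⊤ (v.adicCompletion K)).map (resOfLe (V.geomPrimaryTorsion p) (inf_le_left : ⊤ ⊓ decomp v ≤ ⊤)),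
      p • x = 0 → p • y = 0 → x ≠ 0 → ∃ m : ℤ, y = m • x) :
    ∀ x ∈ (((V.kummerMapPInfty p V.zsmul_geomPoints_surjective_holds).range).map (resSubgroup ⊤ (V.geomPrimaryTorsion p))).map
        (resOfLe (V.geomPrimaryTorsion p) (inf_le_left : ⊤ ⊓ decomp v ≤ ⊤)),
      ∀ y ∈ (((V.kummerMapPInfty p V.zsmul_geomPoints_surjective_holds).range).map (resSubgroup ⊤ (V.geomPrimaryTorsion p))).map
        (resOfLe (V.geomPrimaryTorsion p) (inf_le_left : ⊤ ⊓ decomp v ≤ ⊤)),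
      p • x = 0 → p • y = 0 → x ≠ 0 → ∃ m : ℤ, y = m • x :=
  local_cyclic_mono p (AddSubgroup.map_mono ((map_resSubgroup_kummer_le_map_resSubgroup_selmer V p).trans
    (map_resSubgroup_selmer_le_localKerOver_adicCompletion V p v))) hcl

end Generic

end Summit.BirchSwinnertonDyer.BirchSwinnertonDyer.Theorems.PrintCf2.RestrictedSelmerPair

/-! ## §2. On road α's frame -/

namespace Summit.BirchSwinnertonDyer.BirchSwinnertonDyer.Theorems.PrintCf2.CMPrimes

open Summit.BirchSwinnertonDyer.BirchSwinnertonDyer.Theorems.PrintCf2.RestrictedSelmerPair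
open Summit.BirchSwinnertonDyer.BirchSwinnertonDyer.Theorems.PrintCf2.AdditiveAtSeven

section Frame

variable {K : Type} [Field K] [NumberField K]

/-- **(INF′) on every frame.** For a member `C • W = cm7^{(d)}` (`d ≠ 0`) over a number field `K`, `π ∈ End_K(E_K)` with `π² = π − 2`, a
`2`-adic root `r` of `X² − X + 2` and a `ℚ`-point of infinite order: `ι′_*⁻¹(res_⊤ range κ)` (conjugate summand `E[𝔮_{1−r}^∞]`) is infinite.
[cite: Agboola2007, §6 (arXiv p0014:L5)] [cite: SilvermanAEC2009, VIII §1] -/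
theorem not_finite_comap_conj_kummer_of_frame {d : ℤ} (hd0 : d ≠ 0) (W : WeierstrassCurve ℚ) [W.IsElliptic]
    (C : WeierstrassCurve.VariableChange ℚ) (hCW : C • W = cm7.quadraticTwist (d : ℚ)) (K : Type) [Field K] [NumberField K]
    (π : (W.baseChange K).endRing) (hrel : (π : AddMonoid.End (W.baseChange K).geomPoints) * π = π - 2)
    {r : ℤ_[2]} (hr : r * r = r - 2) (P : W.toAffine.Point) (hP : ¬ IsOfFinAddOrder P) :
    ¬ Finite ↥(((((W.baseChange K).kummerMapPInfty 2 (W.baseChange K).zsmul_geomPoints_surjective_holds).range).map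
        (resSubgroup ⊤ ((W.baseChange K).geomPrimaryTorsion 2))).comap
        (resH1Hom (ContinuousMonoidHom.id (⊤ : Subgroup (absoluteGaloisGroup K))) ((W.baseChange K).endEigenPrimaryTorsion 2 π (1 - r)).subtype
          (fun _ _ ↦ rfl))) := by
  haveI : Fact (Nat.Prime 2) := ⟨Nat.prime_two⟩
  obtain ⟨hinf, hsup⟩ := endEigenPrimaryTorsion_compl_of_frame hd0 W C hCW K π hrel hr
  exact not_finite_comap_conj_kummer (W.baseChange K) 2 π r (1 - r) (two_dvd_or_two_dvd_one_sub_of_root hr).2 hrel hinf hsup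
    (Affine.Point.map (W' := W) (F := ℚ) (Algebra.ofId ℚ K) P) (not_isOfFinAddOrder_map_ofId W hP)

/-- **(H1-Sel) PER FRAME ⟸ (T-loc-cl at `v`) ∧ the frame's `hfin`.** For a member over an imaginary quadratic `K` with `2 = v·v̄`, `π² = π − 2`,
`r² = r − 2`, a `ℚ`-point of infinite order and `𝔖_{v̄}(K, E[𝔮_r^∞])` finite: IF the `2`-torsion of `loc_v` of the classical-at-`v` classes of
`H¹(⊤, E[2^∞])` is cyclic, THEN the `E[𝔮_r^∞]`-component of every Selmer class is zero on `D_v` (-w8 g2's `sel_input_of_finite_conj` with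
`hfin′` by -w2 g10's transport, (INF′) by §1, `φ` the CM isogeny of `π`). [cite: Agboola2007, §6 (arXiv p0014:L5)] [cite: GreenbergLNM1716, §2 Prop. 2.1] -/
theorem sel_input_of_frame_of_locCyclic {d : ℤ} (hd0 : d ≠ 0) (W : WeierstrassCurve ℚ) [W.IsElliptic]
    (C : WeierstrassCurve.VariableChange ℚ) (hCW : C • W = cm7.quadraticTwist (d : ℚ)) (hK : IsImaginaryQuadratic K)
    (v vbar : HeightOneSpectrum (𝓞 K)) (hv : ((2 : ℕ) : 𝓞 K) ∈ v.asIdeal) (hvbar : ((2 : ℕ) : 𝓞 K) ∈ vbar.asIdeal) (hne : vbar ≠ v)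
    (π : (W.baseChange K).endRing) (hrel : (π : AddMonoid.End (W.baseChange K).geomPoints) * π = π - 2)
    {r : ℤ_[2]} (hr : r * r = r - 2) (P : W.toAffine.Point) (hP : ¬ IsOfFinAddOrder P)
    (hcl : ∀ x ∈ (((W.baseChange K).localKerOver 2 ⊤ (v.adicCompletion K)).map
          (resOfLe ((W.baseChange K).geomPrimaryTorsion 2) (inf_le_left : ⊤ ⊓ decomp v ≤ ⊤))),
      ∀ y ∈ (((W.baseChange K).localKerOver 2 ⊤ (v.adicCompletion K)).map
          (resOfLe ((W.baseChange K).geomPrimaryTorsion 2) (inf_le_left : ⊤ ⊓ decomp v ≤ ⊤))),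
      2 • x = 0 → 2 • y = 0 → x ≠ 0 → ∃ m : ℤ, y = m • x)
    (hfin : Finite (restrictedSelmerBase ↥((W.baseChange K).endEigenPrimaryTorsion 2 π r) 2 vbar)) :
    ∀ y₀ ∈ (W.baseChange K).selmerGroupPInfty 2,
      ∀ (c : subgroupH1 (⊤ : Subgroup (absoluteGaloisGroup K)) ↥((W.baseChange K).endEigenPrimaryTorsion 2 π r))
        (c' : subgroupH1 (⊤ : Subgroup (absoluteGaloisGroup K)) ↥((W.baseChange K).endEigenPrimaryTorsion 2 π (1 - r))),
        resH1Hom (ContinuousMonoidHom.id _) ((W.baseChange K).endEigenPrimaryTorsion 2 π r).subtype (fun _ _ ↦ rfl) c +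
            resH1Hom (ContinuousMonoidHom.id _) ((W.baseChange K).endEigenPrimaryTorsion 2 π (1 - r)).subtype (fun _ _ ↦ rfl) c' =
          resSubgroup (⊤ : Subgroup (absoluteGaloisGroup K)) ((W.baseChange K).geomPrimaryTorsion 2) y₀ →
        Literature.NumberTheory.EllipticCurves.resOfLe ↥((W.baseChange K).endEigenPrimaryTorsion 2 π r)
          (inf_le_left : ⊤ ⊓ decomp v ≤ ⊤) c = 0 := by
  haveI : Fact (Nat.Prime 2) := ⟨Nat.prime_two⟩
  obtain ⟨hinf, hsup⟩ := endEigenPrimaryTorsion_compl_of_frame hd0 W C hCW K π hrel hr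
  -- the CM isogeny `φ` of `π`
  have hπG : ∀ (g : absoluteGaloisGroup K) (Q : (W.baseChange K).geomPoints),
      (π : AddMonoid.End (W.baseChange K).geomPoints) (g • Q) = g • (π : AddMonoid.End (W.baseChange K).geomPoints) Q :=
    fun g Q ↦ ((W.baseChange K).mem_equivariantSubring_iff _).1 (Subring.mem_inf.1 π.2).2 g Q
  obtain ⟨φ, hφπ, -⟩ := exists_isogeny_apply_eq_cmEndo (W.baseChange K) (Subring.mem_inf.1 π.2).1 hπG hrel
  exact sel_input_of_finite_conj (W.baseChange K) 2 π r v hK hinf hsup (two_dvd_or_two_dvd_one_sub_of_root hr).2 φ hφπ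
    (ConjTransport.finite_restrictedSelmerBase_conj_of_finite W K hK v vbar hv hvbar hne π hrel r hfin)
    (not_finite_comap_conj_kummer_of_frame hd0 W C hCW K π hrel hr P hP)
    (sel_local_cyclic_of_classical (W.baseChange K) 2 v hcl)

/-- **`hSel` of -w8 g2's `rBV_of_factor_values_of_sel`, VERBATIM, from (T-loc-cl)-all** (the cyclicity of the `2`-torsion of `loc_v` of the
classical classes at `v`, for every frame). [cite: Agboola2007, §6 (arXiv p0014:L5)] [cite: GreenbergLNM1716, §2 Prop. 2.1] -/
theorem hSel_of_locCyclic
    (hcl : ∀ (d : ℤ), d ≠ 0 → Squarefree d → d % 4 ≠ 1 →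
      ∀ (W : WeierstrassCurve ℚ) [W.IsElliptic] [W.IsGloballyMinimal] (C : WeierstrassCurve.VariableChange ℚ),
        C • W = cm7.quadraticTwist (d : ℚ) → W.analyticRank = 1 →
      ∀ (K : Type) [Field K] [NumberField K], IsImaginaryQuadratic K →
      ∀ (v vbar : HeightOneSpectrum (𝓞 K)),
        ((2 : ℕ) : 𝓞 K) ∈ v.asIdeal → ((2 : ℕ) : 𝓞 K) ∈ vbar.asIdeal → vbar ≠ v →
      ∀ (π : (W.baseChange K).endRing), (π : AddMonoid.End (W.baseChange K).geomPoints) * π = π - 2 →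
      ∀ (r : ℤ_[2]), r * r = r - 2 →
        (∀ τ ∈ GreenbergSelmer.inertia v, ∀ x : ↥((W.baseChange K).endEigenPrimaryTorsion 2 π r), τ • x = x ∨ τ • x = -x) →
      ∀ (P : W.toAffine.Point) (c₀ : ℕ) (ℓ : ℤ),
        ¬ IsOfFinAddOrder P →
        (∀ R : W.toAffine.Point, ∃ (k : ℤ) (T : W.toAffine.Point), IsOfFinAddOrder T ∧ R = k • P + T) →
        c₀ ≠ 0 → (W.baseChange ℚ_[2]).IsInReductionKernel (c₀ • W.toPadicPoint 2 P) →
        ‖(W.baseChange ℚ_[2]).padicLogPoint (c₀ • W.toPadicPoint 2 P) / (c₀ : ℚ_[2])‖ = (2 : ℝ) ^ (-ℓ) →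
      Finite (restrictedSelmerBase ↥((W.baseChange K).endEigenPrimaryTorsion 2 π r) 2 vbar) →
        ∀ x ∈ (((W.baseChange K).localKerOver 2 ⊤ (v.adicCompletion K)).map
          (resOfLe ((W.baseChange K).geomPrimaryTorsion 2) (inf_le_left : ⊤ ⊓ decomp v ≤ ⊤))),
        ∀ y ∈ (((W.baseChange K).localKerOver 2 ⊤ (v.adicCompletion K)).map
          (resOfLe ((W.baseChange K).geomPrimaryTorsion 2) (inf_le_left : ⊤ ⊓ decomp v ≤ ⊤))),
          2 • x = 0 → 2 • y = 0 → x ≠ 0 → ∃ m : ℤ, y = m • x) :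
    ∀ (d : ℤ), d ≠ 0 → Squarefree d → d % 4 ≠ 1 →
      ∀ (W : WeierstrassCurve ℚ) [W.IsElliptic] [W.IsGloballyMinimal] (C : WeierstrassCurve.VariableChange ℚ),
        C • W = cm7.quadraticTwist (d : ℚ) → W.analyticRank = 1 →
      ∀ (K : Type) [Field K] [NumberField K], IsImaginaryQuadratic K →
      ∀ (v vbar : HeightOneSpectrum (𝓞 K)),
        ((2 : ℕ) : 𝓞 K) ∈ v.asIdeal → ((2 : ℕ) : 𝓞 K) ∈ vbar.asIdeal → vbar ≠ v →
      ∀ (π : (W.baseChange K).endRing), (π : AddMonoid.End (W.baseChange K).geomPoints) * π = π - 2 →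
      ∀ (r : ℤ_[2]), r * r = r - 2 →
        (∀ τ ∈ GreenbergSelmer.inertia v, ∀ x : ↥((W.baseChange K).endEigenPrimaryTorsion 2 π r), τ • x = x ∨ τ • x = -x) →
      ∀ (P : W.toAffine.Point) (c₀ : ℕ) (ℓ : ℤ),
        ¬ IsOfFinAddOrder P →
        (∀ R : W.toAffine.Point, ∃ (k : ℤ) (T : W.toAffine.Point), IsOfFinAddOrder T ∧ R = k • P + T) →
        c₀ ≠ 0 → (W.baseChange ℚ_[2]).IsInReductionKernel (c₀ • W.toPadicPoint 2 P) →
        ‖(W.baseChange ℚ_[2]).padicLogPoint (c₀ • W.toPadicPoint 2 P) / (c₀ : ℚ_[2])‖ = (2 : ℝ) ^ (-ℓ) →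
      Finite (restrictedSelmerBase ↥((W.baseChange K).endEigenPrimaryTorsion 2 π r) 2 vbar) →
        ∀ y₀ ∈ (W.baseChange K).selmerGroupPInfty 2,
          ∀ (c : subgroupH1 (⊤ : Subgroup (absoluteGaloisGroup K)) ↥((W.baseChange K).endEigenPrimaryTorsion 2 π r))
            (c' : subgroupH1 (⊤ : Subgroup (absoluteGaloisGroup K)) ↥((W.baseChange K).endEigenPrimaryTorsion 2 π (1 - r))),
            resH1Hom (ContinuousMonoidHom.id _) ((W.baseChange K).endEigenPrimaryTorsion 2 π r).subtype (fun _ _ ↦ rfl) c +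
                resH1Hom (ContinuousMonoidHom.id _) ((W.baseChange K).endEigenPrimaryTorsion 2 π (1 - r)).subtype (fun _ _ ↦ rfl) c' =
              resSubgroup (⊤ : Subgroup (absoluteGaloisGroup K)) ((W.baseChange K).geomPrimaryTorsion 2) y₀ →
            Literature.NumberTheory.EllipticCurves.resOfLe ↥((W.baseChange K).endEigenPrimaryTorsion 2 π r)
              (inf_le_left : ⊤ ⊓ decomp v ≤ ⊤) c = 0 := by
  intro d hd0 _ _ W _ _ C hC _ K _ _ hK v vbar hv hvbar hne π hπ r hr _ P c₀ ℓ hP hgen hc₀ hker hlog hfin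
  exact sel_input_of_frame_of_locCyclic hd0 W C hC hK v vbar hv hvbar hne π hπ hr P hP
    (hcl d hd0 ‹_› ‹_› W C hC ‹_› K hK v vbar hv hvbar hne π hπ r hr ‹_› P c₀ ℓ hP hgen hc₀ hker hlog hfin) hfin

/-- **(R-BV) OF LEAD g12, VERBATIM, from (F1), (F3), (H2) and (T-loc-cl)-all** — -w8 g2's `rBV_of_factor_values_of_sel` with `hSel` by
`hSel_of_locCyclic`: the CM input of the bottom value is a single LOCAL CYCLICITY at `v`. [cite: Agboola2007, Props. 6.10, 6.11, 8.1 (arXiv p0014–p0017)]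
[cite: GreenbergLNM1716, §2] -/
theorem rBV_of_factor_values_of_locCyclic
    (hF1 : ∃ e₁ : ℤ → ℤ → ℤ, ∀ (d : ℤ), d ≠ 0 → Squarefree d → d % 4 ≠ 1 →
      ∀ (W : WeierstrassCurve ℚ) [W.IsElliptic] [W.IsGloballyMinimal] (C : WeierstrassCurve.VariableChange ℚ),
        C • W = cm7.quadraticTwist (d : ℚ) → W.analyticRank = 1 →
      ∀ (K : Type) [Field K] [NumberField K], IsImaginaryQuadratic K →
      ∀ (v vbar : HeightOneSpectrum (𝓞 K)),
        ((2 : ℕ) : 𝓞 K) ∈ v.asIdeal → ((2 : ℕ) : 𝓞 K) ∈ vbar.asIdeal → vbar ≠ v →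
      ∀ (π : (W.baseChange K).endRing), (π : AddMonoid.End (W.baseChange K).geomPoints) * π = π - 2 →
      ∀ (r : ℤ_[2]), r * r = r - 2 →
        (∀ τ ∈ GreenbergSelmer.inertia v, ∀ x : ↥((W.baseChange K).endEigenPrimaryTorsion 2 π r), τ • x = x ∨ τ • x = -x) →
      ∀ (P : W.toAffine.Point) (c₀ : ℕ) (ℓ : ℤ),
        ¬ IsOfFinAddOrder P →
        (∀ R : W.toAffine.Point, ∃ (k : ℤ) (T : W.toAffine.Point), IsOfFinAddOrder T ∧ R = k • P + T) →
        c₀ ≠ 0 → (W.baseChange ℚ_[2]).IsInReductionKernel (c₀ • W.toPadicPoint 2 P) →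
        ‖(W.baseChange ℚ_[2]).padicLogPoint (c₀ • W.toPadicPoint 2 P) / (c₀ : ℚ_[2])‖ = (2 : ℝ) ^ (-ℓ) →
      Finite (restrictedSelmerBase ↥((W.baseChange K).endEigenPrimaryTorsion 2 π r) 2 vbar) →
        (padicValNat 2 (Nat.card ↥(((((W.baseChange K).kummerMapPInfty 2 (W.baseChange K).zsmul_geomPoints_surjective_holds).range).map
            (resSubgroup ⊤ ((W.baseChange K).geomPrimaryTorsion 2))).comap
          (resH1Hom (ContinuousMonoidHom.id _) ((W.baseChange K).endEigenPrimaryTorsion 2 π r).subtype (fun _ _ ↦ rfl)) ⊓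
          (resOfLe ↥((W.baseChange K).endEigenPrimaryTorsion 2 π r) (inf_le_left : ⊤ ⊓ decomp vbar ≤ ⊤)).ker)) : ℤ) = ℓ + e₁ (d % 2) ((d / (2 - d % 2)) % 8))
    (hF3 : ∃ e₃ : ℤ → ℤ → ℤ, ∀ (d : ℤ), d ≠ 0 → Squarefree d → d % 4 ≠ 1 →
      ∀ (W : WeierstrassCurve ℚ) [W.IsElliptic] [W.IsGloballyMinimal] (C : WeierstrassCurve.VariableChange ℚ),
        C • W = cm7.quadraticTwist (d : ℚ) → W.analyticRank = 1 →
      ∀ (K : Type) [Field K] [NumberField K], IsImaginaryQuadratic K →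
      ∀ (v vbar : HeightOneSpectrum (𝓞 K)),
        ((2 : ℕ) : 𝓞 K) ∈ v.asIdeal → ((2 : ℕ) : 𝓞 K) ∈ vbar.asIdeal → vbar ≠ v →
      ∀ (π : (W.baseChange K).endRing), (π : AddMonoid.End (W.baseChange K).geomPoints) * π = π - 2 →
      ∀ (r : ℤ_[2]), r * r = r - 2 →
        (∀ τ ∈ GreenbergSelmer.inertia v, ∀ x : ↥((W.baseChange K).endEigenPrimaryTorsion 2 π r), τ • x = x ∨ τ • x = -x) →
      ∀ (P : W.toAffine.Point) (c₀ : ℕ) (ℓ : ℤ),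
        ¬ IsOfFinAddOrder P →
        (∀ R : W.toAffine.Point, ∃ (k : ℤ) (T : W.toAffine.Point), IsOfFinAddOrder T ∧ R = k • P + T) →
        c₀ ≠ 0 → (W.baseChange ℚ_[2]).IsInReductionKernel (c₀ • W.toPadicPoint 2 P) →
        ‖(W.baseChange ℚ_[2]).padicLogPoint (c₀ • W.toPadicPoint 2 P) / (c₀ : ℚ_[2])‖ = (2 : ℝ) ^ (-ℓ) →
      Finite (restrictedSelmerBase ↥((W.baseChange K).endEigenPrimaryTorsion 2 π r) 2 vbar) →
        (padicValNat 2 (Nat.card ((resOfLe ↥((W.baseChange K).endEigenPrimaryTorsion 2 π r) (inf_le_left : ⊤ ⊓ decomp v ≤ ⊤)).comp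
          (restrictedSelmerBase ↥((W.baseChange K).endEigenPrimaryTorsion 2 π r) 2 vbar).subtype).range) : ℤ) = ℓ + e₃ (d % 2) ((d / (2 - d % 2)) % 8))
    (hH2 : ∀ (d : ℤ), d ≠ 0 → Squarefree d → d % 4 ≠ 1 →
      ∀ (W : WeierstrassCurve ℚ) [W.IsElliptic] [W.IsGloballyMinimal] (C : WeierstrassCurve.VariableChange ℚ),
        C • W = cm7.quadraticTwist (d : ℚ) → W.analyticRank = 1 →
      ∀ (K : Type) [Field K] [NumberField K], IsImaginaryQuadratic K →
      ∀ (v vbar : HeightOneSpectrum (𝓞 K)),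
        ((2 : ℕ) : 𝓞 K) ∈ v.asIdeal → ((2 : ℕ) : 𝓞 K) ∈ vbar.asIdeal → vbar ≠ v →
      ∀ (π : (W.baseChange K).endRing), (π : AddMonoid.End (W.baseChange K).geomPoints) * π = π - 2 →
      ∀ (r : ℤ_[2]), r * r = r - 2 →
        (∀ τ ∈ GreenbergSelmer.inertia v, ∀ x : ↥((W.baseChange K).endEigenPrimaryTorsion 2 π r), τ • x = x ∨ τ • x = -x) →
      ∀ (P : W.toAffine.Point) (c₀ : ℕ) (ℓ : ℤ),
        ¬ IsOfFinAddOrder P →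
        (∀ R : W.toAffine.Point, ∃ (k : ℤ) (T : W.toAffine.Point), IsOfFinAddOrder T ∧ R = k • P + T) →
        c₀ ≠ 0 → (W.baseChange ℚ_[2]).IsInReductionKernel (c₀ • W.toPadicPoint 2 P) →
        ‖(W.baseChange ℚ_[2]).padicLogPoint (c₀ • W.toPadicPoint 2 P) / (c₀ : ℚ_[2])‖ = (2 : ℝ) ^ (-ℓ) →
      Finite (restrictedSelmerBase ↥((W.baseChange K).endEigenPrimaryTorsion 2 π r) 2 vbar) →
        (restrictedSelmerBase ↥((W.baseChange K).endEigenPrimaryTorsion 2 π r) 2 v ⊓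
            (((W.baseChange K).localKerOver 2 ⊤ (vbar.adicCompletion K)).comap
          (resH1Hom (ContinuousMonoidHom.id _) ((W.baseChange K).endEigenPrimaryTorsion 2 π r).subtype (fun _ _ ↦ rfl)))).map
            (resOfLe ↥((W.baseChange K).endEigenPrimaryTorsion 2 π r) (inf_le_left : ⊤ ⊓ decomp vbar ≤ ⊤)) ≤
          (((((W.baseChange K).kummerMapPInfty 2 (W.baseChange K).zsmul_geomPoints_surjective_holds).range).map
            (resSubgroup ⊤ ((W.baseChange K).geomPrimaryTorsion 2))).comap
          (resH1Hom (ContinuousMonoidHom.id _) ((W.baseChange K).endEigenPrimaryTorsion 2 π r).subtype (fun _ _ ↦ rfl))).map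
            (resOfLe ↥((W.baseChange K).endEigenPrimaryTorsion 2 π r) (inf_le_left : ⊤ ⊓ decomp vbar ≤ ⊤)))
    (hcl : ∀ (d : ℤ), d ≠ 0 → Squarefree d → d % 4 ≠ 1 →
      ∀ (W : WeierstrassCurve ℚ) [W.IsElliptic] [W.IsGloballyMinimal] (C : WeierstrassCurve.VariableChange ℚ),
        C • W = cm7.quadraticTwist (d : ℚ) → W.analyticRank = 1 →
      ∀ (K : Type) [Field K] [NumberField K], IsImaginaryQuadratic K →
      ∀ (v vbar : HeightOneSpectrum (𝓞 K)),
        ((2 : ℕ) : 𝓞 K) ∈ v.asIdeal → ((2 : ℕ) : 𝓞 K) ∈ vbar.asIdeal → vbar ≠ v →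
      ∀ (π : (W.baseChange K).endRing), (π : AddMonoid.End (W.baseChange K).geomPoints) * π = π - 2 →
      ∀ (r : ℤ_[2]), r * r = r - 2 →
        (∀ τ ∈ GreenbergSelmer.inertia v, ∀ x : ↥((W.baseChange K).endEigenPrimaryTorsion 2 π r), τ • x = x ∨ τ • x = -x) →
      ∀ (P : W.toAffine.Point) (c₀ : ℕ) (ℓ : ℤ),
        ¬ IsOfFinAddOrder P →
        (∀ R : W.toAffine.Point, ∃ (k : ℤ) (T : W.toAffine.Point), IsOfFinAddOrder T ∧ R = k • P + T) →
        c₀ ≠ 0 → (W.baseChange ℚ_[2]).IsInReductionKernel (c₀ • W.toPadicPoint 2 P) →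
        ‖(W.baseChange ℚ_[2]).padicLogPoint (c₀ • W.toPadicPoint 2 P) / (c₀ : ℚ_[2])‖ = (2 : ℝ) ^ (-ℓ) →
      Finite (restrictedSelmerBase ↥((W.baseChange K).endEigenPrimaryTorsion 2 π r) 2 vbar) →
        ∀ x ∈ (((W.baseChange K).localKerOver 2 ⊤ (v.adicCompletion K)).map
          (resOfLe ((W.baseChange K).geomPrimaryTorsion 2) (inf_le_left : ⊤ ⊓ decomp v ≤ ⊤))),
        ∀ y ∈ (((W.baseChange K).localKerOver 2 ⊤ (v.adicCompletion K)).map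
          (resOfLe ((W.baseChange K).geomPrimaryTorsion 2) (inf_le_left : ⊤ ⊓ decomp v ≤ ⊤))),
          2 • x = 0 → 2 • y = 0 → x ≠ 0 → ∃ m : ℤ, y = m • x) :
    ∃ eK : ℤ → ℤ → ℤ, ∀ (d : ℤ), d ≠ 0 → Squarefree d → d % 4 ≠ 1 →
      ∀ (W : WeierstrassCurve ℚ) [W.IsElliptic] [W.IsGloballyMinimal] (C : WeierstrassCurve.VariableChange ℚ),
        C • W = cm7.quadraticTwist (d : ℚ) → W.analyticRank = 1 →
      ∀ (K : Type) [Field K] [NumberField K], IsImaginaryQuadratic K →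
      ∀ (v vbar : HeightOneSpectrum (𝓞 K)),
        ((2 : ℕ) : 𝓞 K) ∈ v.asIdeal → ((2 : ℕ) : 𝓞 K) ∈ vbar.asIdeal → vbar ≠ v →
      ∀ (π : (W.baseChange K).endRing), (π : AddMonoid.End (W.baseChange K).geomPoints) * π = π - 2 →
      ∀ (r : ℤ_[2]), r * r = r - 2 →
        (∀ τ ∈ GreenbergSelmer.inertia v, ∀ x : ↥((W.baseChange K).endEigenPrimaryTorsion 2 π r), τ • x = x ∨ τ • x = -x) →
      ∀ (P : W.toAffine.Point) (c₀ : ℕ) (ℓ : ℤ),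
        ¬ IsOfFinAddOrder P →
        (∀ R : W.toAffine.Point, ∃ (k : ℤ) (T : W.toAffine.Point), IsOfFinAddOrder T ∧ R = k • P + T) →
        c₀ ≠ 0 → (W.baseChange ℚ_[2]).IsInReductionKernel (c₀ • W.toPadicPoint 2 P) →
        ‖(W.baseChange ℚ_[2]).padicLogPoint (c₀ • W.toPadicPoint 2 P) / (c₀ : ℚ_[2])‖ = (2 : ℝ) ^ (-ℓ) →
      Finite (restrictedSelmerBase ↥((W.baseChange K).endEigenPrimaryTorsion 2 π r) 2 vbar) →
        (padicValNat 2 (Nat.card (restrictedSelmerBase ↥((W.baseChange K).endEigenPrimaryTorsion 2 π r) 2 vbar)) : ℤ) =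
          (padicValNat 2 (Nat.card (AddCommGroup.primaryComponent W.sha 2)) : ℤ) + 2 * ℓ + eK (d % 2) ((d / (2 - d % 2)) % 8) :=
  rBV_of_factor_values_of_sel hF1 hF3 hH2 (hSel_of_locCyclic hcl)

end Frame

end Summit.BirchSwinnertonDyer.BirchSwinnertonDyer.Theorems.PrintCf2.CMPrimes

end
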